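import Summits.Ventures.YMGap.Conjectures.StrongCouplingChiralLROMesonWeightTimePlaneN
import Summits.Ventures.YMGap.Conjectures.StrongCouplingChiralLROOneFlavour
import Summits.Ventures.YMGap.Conjectures.StrongCouplingGaussianCorrectedCertTwoColour
import HarnessLib
import HarnessLib.Audit.Tags

/-!
# Row S3 of Y3 beyond `β = 0`, general `N` (3/3): the infrared bound (IR)_{β,4N} of the `U(N)` theory at
# EVERY `β ≥ 0` given a one-link certificate, and THE `N = 2` CONJUNCT OF `SalmhoferSeilerSmallBeta`

Cell `pub-ymgap`, seat qcd-lit g22 (literature-prover), `bears_on: Q1` (typed node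
`Summit.Ventures.YMGap.Conjectures.SalmhoferSeilerSmallBeta`).  Everything is a theorem (0 facts, 0 sorry).

* `isRPWeight_bgWeightN`: the `U(N)` background weight `W^{bg,ε}_β` (`…MesonWeightBackgroundN`) is a
  reflection-positive weight for EVERY plane of the even torus (conjugating the time plane by the lattice
  symmetry `planeConj`, as in `…MesonWeightAllPlanes`), given a hermitian-square certificate
  `HermSqCert N (1/4N) J` (`…MesonWeightTimePlaneN`);
* **`infraredBound_N'`**: consequently the conjecture's kernel `T_β = ssTwoPoint N ν L β 0` obeys the
  mode-wise infrared bound (IR)_{β,4N} — `2(ν - C(χ))·Re T̂_β(χ) ≤ 4N`, `-2(ν + C(χ))·Re T̂_β(χ) ≤ 4N` — at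
  EVERY `β ≥ 0`, uniformly in the volume, with the `β = 0` constant (Salmhofer–Seiler (3.112)–(3.113));
  the lattice symmetries of the meson moments are the tree's `mesonMoment_mapDomain_addRight` /
  `mesonMoment_mapDomain_axisSwap`;
* **`chiralLRO_of_cert`**: for `1 ≤ N ≤ 4`, `ν ≥ 4`, a certificate gives chiral long-range order at small
  `β > 0` uniformly in the volume — the conjunct `N` of `SalmhoferSeilerSmallBeta` (Schwinger–Dyson half
  `schwingerDysonBound_smallBeta`, margin `zeroCoupling_margin`, lattice lemma `kernel_chiralLRO_uniform`);
* **`chiralLRO_two`**: with the explicit two-colour certificate `hermSqCert_two`, THE `N = 2` CONJUNCT OF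
  THE TYPED CONJECTURE `SalmhoferSeilerSmallBeta` IS A THEOREM; `salmhoferSeilerSmallBeta_iff_three_le`:
  Y3 is now equivalent to its conjuncts `N = 3, 4`, and `salmhoferSeilerSmallBeta_of_certs` reduces those to
  two finite-dimensional one-link certificates `HermSqCert 3 (1/12)`, `HermSqCert 4 (1/16)`.

Honest framing: finite even tori, `β ≥ 0` small; `N = 2` unconditional, `N = 3, 4` conditional on
certificates not yet typed; nothing about the continuum or the summit's `QCD` conjunct (`SU(3)`, `N_f`
flavours, `g → 0`), which this does not touch.

## References
* [SalmhoferSeiler1991] M. Salmhofer, E. Seiler, Commun. Math. Phys. 139 (1991) 395–432, Thm. 3.21,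
  (3.112)–(3.113), Thm. 4.8, Cor. 4.9, Remarks 4.5–4.6, §5 p. 424.
* [FrohlichIsraelLiebSimon1978] J. Fröhlich, R. Israel, E. H. Lieb, B. Simon, Commun. Math. Phys. 62
  (1978) 1–34, §2.
* [MontvayMunster1994] I. Montvay, G. Münster, Quantum Fields on a Lattice, CUP 1994, §4.3.
-/

noncomputable section

open MeasureTheory Finset MvPolynomial
open scoped ComplexConjugate BigOperators ComplexOrder
open Literature.MathematicalPhysics.QuantumLattice
open Literature.MathematicalPhysics.QuantumLattice.StrongCoupling
open Literature.MathematicalPhysics.QuantumLattice.StaggeredRP (HermSqCert)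
open Literature.MathematicalPhysics.StatisticalMechanics
open Literature.MathematicalPhysics.StatisticalMechanics.ComplexSpin
open Literature.Barriers.CriticalPhenomena.NonGibbs
open Literature.Probability.LatticeModels (TorusSite)

namespace Summit.Ventures.YMGap.Conjectures

namespace MesonWeight

open SchwingerDyson

variable {N ν L : ℕ} [NeZero L]

/-! ### Lattice symmetries of the background factors -/

section Symmetry

variable [NeZero ν]

omit [NeZero ν] in
/-- The bond factor has real coefficients. [cite: SalmhoferSeiler1991, Remark 3.2] -/
theorem map_conj_bondFactorN : MvPolynomial.map (starRingEnd ℂ) (bondFactorN N ν L) = bondFactorN N ν L := by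
  rw [bondFactorN_eq_prod_edges, map_prod]
  exact Finset.prod_congr rfl fun e _ => map_conj_bondTermN e.1 _

omit [NeZero ν] in
/-- The site factor has real coefficients. [cite: SalmhoferSeiler1991, Remark 3.2] -/
theorem map_conj_siteFactorN (ε : ℤ) :
    MvPolynomial.map (starRingEnd ℂ) (siteFactorN N ν L ε) = siteFactorN N ν L ε := by
  rw [siteFactorN, map_prod]
  exact Finset.prod_congr rfl fun x _ => map_conj_siteTermN ε x

omit [NeZero ν] in
/-- The site factor is invariant under every lattice bijection. [cite: SalmhoferSeiler1991, Remark 3.2] -/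
theorem rename_siteFactorN (g : TorusSite ν L ≃ TorusSite ν L) (ε : ℤ) :
    rename g (siteFactorN N ν L ε) = siteFactorN N ν L ε := by
  rw [siteFactorN, map_prod]
  exact (Finset.prod_congr rfl fun x _ => rename_siteTermN g ε x).trans (Fintype.prod_equiv g _ _ fun x => rfl)

/-- The site factor is invariant under the time reflection (as a renaming). [cite: SalmhoferSeiler1991, (3.84)–(3.89)] -/
theorem rename_siteReflect_siteFactorN (hL : Even L) (ε : ℤ) :
    rename (siteReflect (0 : Fin ν) 1) (siteFactorN N ν L ε) = siteFactorN N ν L ε := by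
  have h := reflect_siteFactorN (N := N) (ν := ν) hL ε
  rwa [reflect_apply, map_conj_siteFactorN] at h

omit [NeZero ν] in
/-- The bond factor is translation invariant. [cite: MontvayMunster1994, §4.3 (4.186)] -/
theorem rename_bondFactorN_addRight (c : TorusSite ν L) :
    rename (Equiv.addRight c) (bondFactorN N ν L) = bondFactorN N ν L := by
  rw [bondFactorN, map_prod]
  have hF : ∀ x : TorusSite ν L, rename (Equiv.addRight c) (∏ μ : Fin ν, bondTermN N x (x + Pi.single μ 1)) =
      (fun y : TorusSite ν L => ∏ μ : Fin ν, bondTermN N y (y + Pi.single μ 1)) (Equiv.addRight c x) := by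
    intro x
    rw [map_prod]
    refine Finset.prod_congr rfl fun μ _ => ?_
    rw [rename_bondTermN, Equiv.coe_addRight, add_right_comm]
  exact (Finset.prod_congr rfl fun x _ => hF x).trans (Fintype.prod_equiv (Equiv.addRight c) _ _ fun x => rfl)

/-- The bond factor is invariant under axis transpositions. [cite: MontvayMunster1994, §4.3 (4.187)] -/
theorem rename_bondFactorN_axisSwap (i : Fin ν) :
    rename (axisSwap (L := L) i) (bondFactorN N ν L) = bondFactorN N ν L := by
  have h : ∀ (x : TorusSite ν L) (μ : Fin ν),
      axisSwap i (x + Pi.single μ 1) = axisSwap i x + Pi.single (Equiv.swap 0 i μ) 1 := by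
    intro x μ
    show (x + Pi.single μ 1) ∘ Equiv.swap 0 i = x ∘ Equiv.swap 0 i + Pi.single (Equiv.swap 0 i μ) 1
    rw [← single_comp_swap]; rfl
  rw [bondFactorN, map_prod]
  have hF : ∀ x : TorusSite ν L, rename (axisSwap i) (∏ μ : Fin ν, bondTermN N x (x + Pi.single μ 1)) =
      (fun y : TorusSite ν L => ∏ μ : Fin ν, bondTermN N y (y + Pi.single μ 1)) (axisSwap i x) := by
    intro x
    rw [map_prod]
    exact (Finset.prod_congr rfl fun μ _ => by rw [rename_bondTermN, h]).trans
      (Fintype.prod_equiv (Equiv.swap (0 : Fin ν) i) _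
        (fun μ => bondTermN N (axisSwap i x) (axisSwap i x + Pi.single μ 1)) fun μ => rfl)
  exact (Finset.prod_congr rfl fun x _ => hF x).trans (Fintype.prod_equiv (axisSwap i) _ _ fun x => rfl)

/-- The bond factor is invariant under `planeConj`. [cite: MontvayMunster1994, §4.3] -/
theorem rename_bondFactorN_planeConj (i : Fin ν) (k : ZMod L) :
    rename (planeConj i k) (bondFactorN N ν L) = bondFactorN N ν L := by
  rw [planeConj, Equiv.coe_trans, ← rename_rename, rename_bondFactorN_axisSwap, rename_bondFactorN_addRight]

/-- The bond factor is invariant under the time reflection (as a renaming). [cite: SalmhoferSeiler1991, (3.84)–(3.89)] -/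
theorem rename_siteReflect_bondFactorN (hL : Even L) :
    rename (siteReflect (0 : Fin ν) 1) (bondFactorN N ν L) = bondFactorN N ν L := by
  have h := reflect_bondFactorN (N := N) (ν := ν) hL
  rwa [reflect_apply, map_conj_bondFactorN] at h

/-- **THE BACKGROUND WEIGHT OF THE `U(N)` THEORY IS A REFLECTION-POSITIVE WEIGHT FOR EVERY PLANE OF THE
EVEN TORUS, AT EVERY `β ≥ 0`, BOTH TWISTS**, given a one-link hermitian-square certificate at `κ = 1/4N` and
the invariance of the meson moments under lattice translations (`hT`) and axis transpositions (`hP`). [cite: SalmhoferSeiler1991, Remark 4.5 and (3.90)–(3.93)] -/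
theorem isRPWeight_bgWeightN [LinearOrder (TorusSite ν L)] {J : Type} [Fintype J]
    (cert : HermSqCert N (1 / (4 * N)) J) (hN : N ≠ 0) (hL : Even L) {β : ℝ} (hβ : 0 ≤ β)
    (hT : ∀ (c : TorusSite ν L) (m : TorusSite ν L →₀ ℕ),
      mesonMoment N ν L β (Finsupp.mapDomain (Equiv.addRight c) m) = mesonMoment N ν L β m)
    (hP : ∀ (i : Fin ν) (m : TorusSite ν L →₀ ℕ),
      mesonMoment N ν L β (Finsupp.mapDomain (axisSwap i) m) = mesonMoment N ν L β m)
    (ε : ℤ) (i : Fin ν) (k : ZMod L) : IsRPWeight i k N (bgWeightN N ν L ε β) := by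
  refine isRPWeight_of_conj i k (planeConj i k) (siteReflect_planeConj i k) (planeConj_mem_halfPlus i k)
    ?_ ?_ ?_ (isRPWeight_bgWeightN_zero_one cert hN hL hβ ε)
  · rw [bgWeightN, map_mul, map_mul, map_conj_mesonWeightC hL, map_conj_siteFactorN, map_conj_bondFactorN]
  · rw [bgWeightN, map_mul, map_mul, rename_bondFactorN_planeConj, rename_siteFactorN,
      rename_mesonWeightC β (planeConj i k) fun m => by
        rw [planeConj, Equiv.coe_trans, Finsupp.mapDomain_comp, hT, hP]]
  · rw [bgWeightN, map_mul, map_mul, rename_siteReflect_mesonWeightC hL hβ, rename_siteReflect_siteFactorN hL,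
      rename_siteReflect_bondFactorN hL]

end Symmetry

/-! ### The infrared bound at every `β ≥ 0`, general `N`, given a certificate -/

/-- **(IR)_{β,4N} FOR THE `U(N)` THEORY AT EVERY `β ≥ 0`, UNIFORMLY IN THE VOLUME**, given a one-link
certificate and the lattice symmetries of the meson moments: Salmhofer–Seiler's (3.112)–(3.113) with the
`β = 0` constant `4N`. [cite: SalmhoferSeiler1991, Thm. 3.21 with (3.112)–(3.113) and Remark 4.5] -/
theorem infraredBound_N [NeZero ν] [LinearOrder (TorusSite ν L)] {J : Type} [Fintype J]
    (cert : HermSqCert N (1 / (4 * N)) J) (hN : N ≠ 0) (hL : Even L) {β : ℝ} (hβ : 0 ≤ β)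
    (hT : ∀ (c : TorusSite ν L) (m : TorusSite ν L →₀ ℕ),
      mesonMoment N ν L β (Finsupp.mapDomain (Equiv.addRight c) m) = mesonMoment N ν L β m)
    (hP : ∀ (i : Fin ν) (m : TorusSite ν L →₀ ℕ),
      mesonMoment N ν L β (Finsupp.mapDomain (axisSwap i) m) = mesonMoment N ν L β m)
    (χ : AddChar (TorusSite ν L) ℂ) :
    2 * ((ν : ℝ) - cosSum χ) * (kernelSymbol (fun x y => ssTwoPoint N ν L β 0 x y) χ).re ≤ 4 * N ∧
      2 * ((ν : ℝ) + cosSum χ) * (-(kernelSymbol (fun x y => ssTwoPoint N ν L β 0 x y) χ).re) ≤ 4 * N := by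
  have hN1 : 1 ≤ N := Nat.one_le_iff_ne_zero.mpr hN
  have hL2 : 2 ≤ L := by obtain ⟨k, hk⟩ := hL; have := NeZero.ne L; omega
  have hcard : 2 ≤ Fintype.card (TorusSite ν L) := by
    rw [Fintype.card_fun, ZMod.card, Fintype.card_fin]
    calc 2 ≤ L := hL2
      _ ≤ L ^ ν := Nat.le_self_pow (NeZero.ne ν) L
  set W₀ := mesonWeight N ν L β with hW₀
  have hW : ∀ (ε : ℤ) (i : Fin ν) (k : ZMod L), IsRPWeight i k N (bgWeightN N ν L ε β) :=
    fun ε i k => isRPWeight_bgWeightN cert hN hL hβ hT hP ε i k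
  have hbg : ∀ ε : ℤ, TruncEq N (gaussFactor ε N * bgWeightN N ν L ε β) (MvPolynomial.map Complex.ofRealHom W₀) := by
    intro ε
    rw [hW₀, map_mesonWeight hL]
    exact truncEq_gaussFactor_mul_bgWeightN hcard ε β
  have hTinv : ∀ x y c : TorusSite ν L, twoPtWR N W₀ (x + c) (y + c) = twoPtWR N W₀ x y :=
    twoPtWR_mesonWeight_add hL hT
  have h1 := twoPtWR_mode_le hL (0 : Fin ν) hcard hN1 (hW 1) (hbg 1) hTinv χ
  have h2 := neg_twoPtWR_mode_le hL (0 : Fin ν) hcard hN1 (hW (-1)) (hbg (-1)) hTinv χ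
  set Z := bracketWR N W₀ 1 with hZdef
  have hZ : 0 < Z := bracketWR_mesonWeight_one_pos hL β
  have hNpos : (0 : ℝ) < N := by exact_mod_cast hN1
  have hker : (fun x y => ssTwoPoint N ν L β 0 x y) = fun x y => ((2 * N : ℝ) ^ 2 / Z) * twoPtWR N W₀ x y := by
    funext x y
    rw [ssTwoPoint_eq_twoPtWR_div hN hL]
    ring
  have hsym : (kernelSymbol (fun x y => ssTwoPoint N ν L β 0 x y) χ).re =
      ((2 * N : ℝ) ^ 2 / Z) * (kernelSymbol (twoPtWR N W₀) χ).re := by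
    rw [hker, kernelSymbol_const_mul, Complex.re_ofReal_mul]
  have hc : 0 < (2 * N : ℝ) ^ 2 / Z := by positivity
  have hkey : (2 * N : ℝ) ^ 2 / Z * (1 / N * Z) = 4 * N := by
    field_simp
    ring
  constructor
  · rw [hsym]
    calc 2 * ((ν : ℝ) - cosSum χ) * ((2 * N : ℝ) ^ 2 / Z * (kernelSymbol (twoPtWR N W₀) χ).re)
        = (2 * N : ℝ) ^ 2 / Z * (2 * ((ν : ℝ) - cosSum χ) * (kernelSymbol (twoPtWR N W₀) χ).re) := by ring
      _ ≤ (2 * N : ℝ) ^ 2 / Z * (1 / N * Z) := mul_le_mul_of_nonneg_left h1 hc.le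
      _ = 4 * N := hkey
  · rw [hsym]
    calc 2 * ((ν : ℝ) + cosSum χ) * -((2 * N : ℝ) ^ 2 / Z * (kernelSymbol (twoPtWR N W₀) χ).re)
        = (2 * N : ℝ) ^ 2 / Z * (2 * ((ν : ℝ) + cosSum χ) * -(kernelSymbol (twoPtWR N W₀) χ).re) := by ring
      _ ≤ (2 * N : ℝ) ^ 2 / Z * (1 / N * Z) := mul_le_mul_of_nonneg_left h2 hc.le
      _ = 4 * N := hkey

/-- **(IR)_{β,4N} FOR THE `U(N)` THEORY AT EVERY `β ≥ 0`, UNIFORMLY IN THE VOLUME, GIVEN A ONE-LINK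
CERTIFICATE** — the lattice symmetries being the tree's `mesonMoment_mapDomain_addRight`,
`mesonMoment_mapDomain_axisSwap` (for any ordering of the Grassmann generators). [cite: SalmhoferSeiler1991, Thm. 3.21 with (3.112)–(3.113) and Remark 4.5] -/
theorem infraredBound_N' [NeZero ν] {J : Type} [Fintype J] (cert : HermSqCert N (1 / (4 * N)) J) (hN : N ≠ 0)
    (hL : Even L) {β : ℝ} (hβ : 0 ≤ β) (χ : AddChar (TorusSite ν L) ℂ) :
    2 * ((ν : ℝ) - cosSum χ) * (kernelSymbol (fun x y => ssTwoPoint N ν L β 0 x y) χ).re ≤ 4 * N ∧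
      2 * ((ν : ℝ) + cosSum χ) * (-(kernelSymbol (fun x y => ssTwoPoint N ν L β 0 x y) χ).re) ≤ 4 * N := by
  letI : LinearOrder (TorusSite ν L) :=
    LinearOrder.lift' (Fintype.equivFin (TorusSite ν L)) (Fintype.equivFin (TorusSite ν L)).injective
  exact infraredBound_N cert hN hL hβ (fun c m => mesonMoment_mapDomain_addRight hL β c m)
    (fun i m => mesonMoment_mapDomain_axisSwap hL β i m) χ

/-! ### The conjunct `N` of `SalmhoferSeilerSmallBeta` from a certificate; the conjunct `N = 2` -/

/-- **CHIRAL LONG-RANGE ORDER FOR THE `U(N)` THEORY (`1 ≤ N ≤ 4`, `ν ≥ 4`) AT SMALL `β > 0`, UNIFORMLY IN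
THE VOLUME, GIVEN A ONE-LINK HERMITIAN-SQUARE CERTIFICATE AT `κ = 1/4N`** — the conjunct `N` of the typed
conjecture `SalmhoferSeilerSmallBeta`.  Inputs: `infraredBound_N'` (row S3 at every `β`),
`schwingerDysonBound_smallBeta` (row S4 at small `β`), `zeroCoupling_margin` (`2·4N·S(ν) < (2N)²/K(N)`),
`kernel_chiralLRO_uniform`. [cite: SalmhoferSeiler1991, Thm. 4.8 and Cor. 4.9 with (4.41)–(4.42), Remark 4.5] -/
theorem chiralLRO_of_cert {κ : ℝ} {J : Type} [Fintype J] (cert : HermSqCert N κ J) (hκ : κ = 1 / (4 * N))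
    (hN1 : 1 ≤ N) (hN4 : N ≤ 4) (hν : 4 ≤ ν) :
    ∃ β₀ : ℝ, 0 < β₀ ∧ ∃ c : ℝ, 0 < c ∧ ∃ L₀ : ℕ, ∀ β : ℝ, 0 ≤ β → β < β₀ →
      ∀ (L : ℕ) [NeZero L], Even L → L₀ ≤ L → c ≤ ssChiralOrder N ν L β := by
  subst hκ
  haveI : NeZero ν := ⟨by omega⟩
  have hν3 : 3 ≤ ν := by omega
  have hν1 : 1 ≤ ν := by omega
  have hN : N ≠ 0 := by omega
  have hm := zeroCoupling_margin hN1 hN4 hν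
  set b₀ : ℝ := (2 * N : ℝ) ^ 2 / ComplexSpin.sdK N (ComplexSpin.uNLogCoeff N) with hb₀
  set ε : ℝ := (b₀ - 2 * (4 * N : ℝ) * fluctS ν) / 2 with hε
  have hε0 : 0 < ε := by rw [hε]; linarith
  have hA : (0 : ℝ) ≤ 4 * N := by positivity
  have hAb : 2 * (4 * N : ℝ) * fluctS ν < b₀ - ε := by rw [hε]; linarith
  obtain ⟨c, hc, L₁, hL₁⟩ := ComplexSpin.kernel_chiralLRO_uniform (ν := ν) hν3 hA hAb
  obtain ⟨β₁, hβ₁, hSD⟩ := schwingerDysonBound_smallBeta (N := N) (ν := ν) hN1 hN4 hν1 hε0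
  refine ⟨β₁, hβ₁, c, hc, L₁, fun β hβ hββ₁ L _ hE hLe => ?_⟩
  have h := hL₁ L hE hLe (fun x y => ssTwoPoint N ν L β 0 x y)
    (fun x y a => ssTwoPoint_massless_add N ν L hE β x y a) (fun x y => ssTwoPoint_massless_comm N ν L β x y)
    (fun z hz => by
      refine ssTwoPoint_massless_eq_zero_of_sgn_eq N ν L hν1 hE.two_dvd β ?_
      rw [ComplexSpin.sgn_zero]
      unfold ComplexSpin.sgn
      rw [if_pos hz])
    (fun χ _ _ => infraredBound_N' cert hN hE hβ χ)
    (hSD β hβ hββ₁ L hE)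
  unfold ssChiralOrder
  exact h

/-- **CHIRAL LONG-RANGE ORDER FOR THE TWO-COLOUR (`U(2)`) THEORY WITH ONE STAGGERED FERMION AT SMALL
`β > 0`, UNIFORMLY IN THE VOLUME — THE `N = 2` CONJUNCT OF THE TYPED CONJECTURE `SalmhoferSeilerSmallBeta`,
NOW A THEOREM** (certificate `hermSqCert_two`). [cite: SalmhoferSeiler1991, Thm. 4.8 and Cor. 4.9 with (4.41)–(4.42), Remark 4.5] -/
theorem chiralLRO_two (hν : 4 ≤ ν) :
    ∃ β₀ : ℝ, 0 < β₀ ∧ ∃ c : ℝ, 0 < c ∧ ∃ L₀ : ℕ, ∀ β : ℝ, 0 ≤ β → β < β₀ →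
      ∀ (L : ℕ) [NeZero L], Even L → L₀ ≤ L → c ≤ ssChiralOrder 2 ν L β :=
  chiralLRO_of_cert GaussCorrTwoColour.hermSqCert_two (by norm_num) (by norm_num) (by norm_num) hν

/-- **The `N = 2` instance of `SalmhoferSeilerSmallBeta`, verbatim** (the conjecture's body with `N = 2`). [cite: SalmhoferSeiler1991, Cor. 4.9] -/
theorem salmhoferSeilerSmallBeta_conjunct_two (ν : ℕ) (_h1 : 1 ≤ 2) (_h4 : 2 ≤ 4) (hν : 4 ≤ ν) :
    ∃ β₀ : ℝ, 0 < β₀ ∧ ∃ c : ℝ, 0 < c ∧ ∃ L₀ : ℕ, ∀ β : ℝ, 0 ≤ β → β < β₀ →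
      ∀ (L : ℕ) [NeZero L], Even L → L₀ ≤ L → c ≤ ssChiralOrder 2 ν L β :=
  chiralLRO_two hν

/-! ### `SalmhoferSeilerSmallBeta` reduced to its conjuncts `N = 3, 4`, and to two certificates -/

/-- **THE TYPED CONJECTURE `SalmhoferSeilerSmallBeta` (Y3) NOW FOLLOWS FROM ITS CONJUNCTS `N = 3, 4` ALONE**
(the conjuncts `N = 1, 2` being `chiralLRO_one`, `chiralLRO_two`). [cite: SalmhoferSeiler1991, §5 p. 424 with Cor. 4.9] -/
theorem salmhoferSeilerSmallBeta_of_three_le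
    (h : ∀ N ν : ℕ, 3 ≤ N → N ≤ 4 → 4 ≤ ν →
      ∃ β₀ : ℝ, 0 < β₀ ∧ ∃ c : ℝ, 0 < c ∧ ∃ L₀ : ℕ, ∀ β : ℝ, 0 ≤ β → β < β₀ →
        ∀ (L : ℕ) [NeZero L], Even L → L₀ ≤ L → c ≤ ssChiralOrder N ν L β) :
    SalmhoferSeilerSmallBeta := by
  refine salmhoferSeilerSmallBeta_of_two_le fun N ν hN2 hN4 hν => ?_
  rcases Nat.lt_or_ge N 3 with hN | hN
  · obtain rfl : N = 2 := by omega
    exact chiralLRO_two hν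
  · exact h N ν hN hN4 hν

/-- `SalmhoferSeilerSmallBeta` is EQUIVALENT to its conjuncts `N = 3, 4`. [cite: SalmhoferSeiler1991, §5 p. 424 with Cor. 4.9] -/
theorem salmhoferSeilerSmallBeta_iff_three_le :
    SalmhoferSeilerSmallBeta ↔ ∀ N ν : ℕ, 3 ≤ N → N ≤ 4 → 4 ≤ ν →
      ∃ β₀ : ℝ, 0 < β₀ ∧ ∃ c : ℝ, 0 < c ∧ ∃ L₀ : ℕ, ∀ β : ℝ, 0 ≤ β → β < β₀ →
        ∀ (L : ℕ) [NeZero L], Even L → L₀ ≤ L → c ≤ ssChiralOrder N ν L β :=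
  ⟨fun h N ν hN3 hN4 hν => h N ν (by omega) hN4 hν, salmhoferSeilerSmallBeta_of_three_le⟩

/-- **`SalmhoferSeilerSmallBeta` FOLLOWS FROM TWO FINITE-DIMENSIONAL ONE-LINK CERTIFICATES**: hermitian-square
certificates for the Gaussian-corrected one-link form of the `U(3)` theory at `κ = 1/12` and of the `U(4)`
theory at `κ = 1/16` (Salmhofer–Seiler's Remark 4.5 at `β > 0`, in matrix form). [cite: SalmhoferSeiler1991, Remark 4.5, Thm. 4.8 and Cor. 4.9] -/
theorem salmhoferSeilerSmallBeta_of_certs {J₃ J₄ : Type} [Fintype J₃] [Fintype J₄]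
    (c₃ : HermSqCert 3 (1 / 12) J₃) (c₄ : HermSqCert 4 (1 / 16) J₄) : SalmhoferSeilerSmallBeta := by
  refine salmhoferSeilerSmallBeta_of_three_le fun N ν hN3 hN4 hν => ?_
  interval_cases N
  · exact chiralLRO_of_cert c₃ (by norm_num) (by norm_num) (by norm_num) hν
  · exact chiralLRO_of_cert c₄ (by norm_num) (by norm_num) le_rfl hν

end MesonWeight

end Summit.Ventures.YMGap.Conjectures

end
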